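import Summits.ValiantsHypothesis.ValiantsHypothesis.Theorems.BarrierLeverAnchoredDoorHitsLowerPairsXElimSplit

/-!
# Support item `AnchoredDoorHitsLowerPairs` (stmt-ValiantsHypothesis-22510), line `anchored-peeling`:
# THE X-ELIMINATION ROW READING — one entry of a row through the split variable `a` at the level parameters
# (part 2b of the x-elimination recursion for Conjecture Z)

Helper file (`--supports stmt-ValiantsHypothesis-22510`; cell valiant-natproofs, rung V4, 𝒟-side door (c); registered line
`Cruxes/AnchoredDoorHitsLowerPairs/Lines/anchored_peeling.lean` v26; node `Stmt.stub_conjZ` (p695484); prover seat val-np-p1 gen 26; memo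
HOME/val-np-p1/g26/MEMO-conjZ-node-valnp1-g26.md §4). Closes NO item. Sequel of `…XElimDefs` / `…XElimSplit`.

**`entry_lv_insert` (ROW READING THROUGH `a`, the heart of the x-elimination step).** For `a ∉ U'` and a column `(L, W)` none of whose labels is rooted
at `a`, at the level parameters (`lvTheta a Θ⁰ cB`, `lvPhi a Φ⁰ Ψ⁰`, `lvPsi a Ψ⁰ cL`):
`entry lv (insert a U') (L, W) = (Σ_{ℓ ∈ L} cL ℓ) · entry lv U' (L, W) + Σ_{B ∈ blocks W} cB B · entry lv U' (insert ({a}|B) L, W \ B)`.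
Proof: term by term over the anchor sets `J ∈ jSet W` — an anchor rooted through `a` with a larger root has level weight `0`; no `a`-root: the label tails
give the factor `Σ cL` (`coeff_insert_mul_tails`); two `a`-roots give `x_a²`; exactly one `a`-root `({a}|B₀)`: pull out `x_a`, its tails are the truncated
exponential of the NEW label `({a}|B₀)` (`tailE_lv_root`), and `J ↦ J.erase ({a}|B₀)` is the bijection onto `jSet (W \ B₀)` (`erase_mem_jSet` /
`insert_mem_jSet`).

WHAT THIS IS NOT: the determinant step and the recursion are in the sequels; nothing on crux stmt-ValiantsHypothesis-14610 or on `VP` versus `VNP`.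
-/

set_option linter.dupNamespace false

namespace Summit.ValiantsHypothesis.ValiantsHypothesis.Theorems.BarrierLever.AnchoredPeeling

open Finset MvPolynomial
open Summit.ValiantsHypothesis.ValiantsHypothesis.Theorems.BarrierLever.BrickCalculus (pexpo pexpo_def pexpo_le_iff pexpo_sub
  pexpo_apply_castAdd pexpo_apply_natAdd)

noncomputable section

namespace XElim

variable {h : ℕ}

/-! ## The row reading through `a` -/

section Row

variable (a : Fin h) (Θ₀ : Anchor h → ℂ) (Φ₀ Ψ₀ : Anchor h → Fin h → ℂ) (cB : Finset (Fin h) → ℂ) (cL : Anchor h → ℂ)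

/-- The level label exponential splits off its `a`-tail. -/
theorem labE_lv (ℓ : Anchor h) :
    labE (lvPsi a Ψ₀ cL) ℓ = labE (trPsi a Ψ₀) ℓ * (1 + C (cL ℓ) * X (Fin.castAdd h a)) := by
  classical
  rw [labE, labE, ← Finset.mul_prod_erase Finset.univ _ (Finset.mem_univ a), ← Finset.mul_prod_erase Finset.univ
    (fun b => 1 + C (trPsi a Ψ₀ ℓ b) * X (Fin.castAdd h b)) (Finset.mem_univ a)]
  have hrest : ∏ b ∈ Finset.univ.erase a, (1 + C (lvPsi a Ψ₀ cL ℓ b) * X (Fin.castAdd h b)) =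
      ∏ b ∈ Finset.univ.erase a, (1 + C (trPsi a Ψ₀ ℓ b) * X (R := ℂ) (Fin.castAdd h b)) :=
    Finset.prod_congr rfl (fun b hb => by rw [lvPsi, trPsi, if_neg (Finset.ne_of_mem_erase hb), if_neg (Finset.ne_of_mem_erase hb)])
  rw [hrest, lvPsi, trPsi, if_pos rfl, if_pos rfl, C_0, zero_mul, add_zero, one_mul]
  ring

/-- The label product at the level parameters. -/
theorem prod_labE_lv (L : Finset (Anchor h)) :
    ∏ ℓ ∈ L, labE (lvPsi a Ψ₀ cL) ℓ = (∏ ℓ ∈ L, labE (trPsi a Ψ₀) ℓ) * ∏ ℓ ∈ L, (1 + C (cL ℓ) * X (Fin.castAdd h a)) := by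
  rw [← Finset.prod_mul_distrib]
  exact Finset.prod_congr rfl (fun ℓ _ => labE_lv a Ψ₀ cL ℓ)

/-- Truncated label exponentials are `x_a`-free. -/
theorem xFree_labE_tr (Ψ : Anchor h → Fin h → ℂ) (ℓ : Anchor h) : XFree a (labE (trPsi a Ψ) ℓ) := by
  rw [XFree, killVars_labE]
  congr 1
  funext ℓ' b; by_cases hb : b = a <;> simp [trPsi, hb]

/-- For an anchor not rooted through `a`, the level tails coincide with their truncation. -/
theorem trPhi_lv_eq_of_notMem {α : Anchor h} (hα : a ∉ α.1) : trPhi a (lvPhi a Φ₀ Ψ₀) α = lvPhi a Φ₀ Ψ₀ α := by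
  funext b
  by_cases hb : b = a
  · simp [trPhi, lvPhi, hb]
  · simp [trPhi, lvPhi, hb, hα]

/-- The `x`-parts of an anchor set avoiding `a` are `x_a`-free at the level parameters, and equal their truncation. -/
theorem killVars_prod_xPartE_lv_of_free {J : Finset (Anchor h)} (hJ : ∀ α ∈ J, a ∉ α.1) :
    ThinStep.killVars {Fin.castAdd h a} (∏ α ∈ J, xPartE (lvPhi a Φ₀ Ψ₀) α) = ∏ α ∈ J, xPartE (lvPhi a Φ₀ Ψ₀) α ∧
    (∏ α ∈ J, xPartE (trPhi a (lvPhi a Φ₀ Ψ₀)) α) = ∏ α ∈ J, xPartE (lvPhi a Φ₀ Ψ₀) α := by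
  have heq : (∏ α ∈ J, xPartE (trPhi a (lvPhi a Φ₀ Ψ₀)) α) = ∏ α ∈ J, xPartE (lvPhi a Φ₀ Ψ₀) α := by
    refine Finset.prod_congr rfl (fun α hα => ?_)
    rw [xPartE, xPartE, tailE, tailE]
    congr 1
    exact Finset.prod_congr rfl (fun b _ => by rw [trPhi_lv_eq_of_notMem a Φ₀ Ψ₀ (hJ α hα)])
  refine ⟨?_, heq⟩
  rw [killVars_prod_xPartE, if_neg (by push Not; exact hJ), heq]

/-- The `x`-tails of the new anchor `({a}|B)` at the level parameters are the truncated label exponential of `({a}|B)`. -/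
theorem tailE_lv_root (B : Finset (Fin h)) :
    tailE (lvPhi a Φ₀ Ψ₀) (({a} : Finset (Fin h)), B) = labE (trPsi a Ψ₀) (({a} : Finset (Fin h)), B) := by
  classical
  rw [tailE, labE, ← Finset.mul_prod_erase Finset.univ _ (Finset.mem_univ a)]
  simp only
  rw [trPsi, if_pos rfl, C_0, zero_mul, add_zero, one_mul, show (Finset.univ : Finset (Fin h)) \ {a} = Finset.univ.erase a from
    (Finset.erase_eq Finset.univ a).symm]
  refine Finset.prod_congr rfl (fun b hb => ?_)
  rw [lvPhi, trPsi, if_neg (Finset.ne_of_mem_erase hb), if_neg (Finset.ne_of_mem_erase hb), if_pos rfl]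

/-- **ROW READING THROUGH `a` (the x-elimination split of one entry).** For `a ∉ U'` and a column `(L, W)` none of whose labels is rooted at
`a`: `entry lv (insert a U') (L, W) = (Σ_{ℓ∈L} cL ℓ) · entry lv U' (L, W) + Σ_{B ∈ blocks W} cB B · entry lv U' (insert ({a}|B) L, W \ B)`. -/
theorem entry_lv_insert {U' : Finset (Fin h)} (hU' : a ∉ U') (L : Finset (Anchor h)) (W : Finset (Fin h))
    (hL : ∀ ℓ ∈ L, ℓ.1 ≠ {a}) :
    entry (lvTheta a Θ₀ cB) (lvPhi a Φ₀ Ψ₀) (lvPsi a Ψ₀ cL) (insert a U') (L, W) =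
      (∑ ℓ ∈ L, cL ℓ) * entry (lvTheta a Θ₀ cB) (lvPhi a Φ₀ Ψ₀) (lvPsi a Ψ₀ cL) U' (L, W) +
      ∑ B ∈ blocks W, cB B * entry (lvTheta a Θ₀ cB) (lvPhi a Φ₀ Ψ₀) (lvPsi a Ψ₀ cL) U' (insert (({a} : Finset (Fin h)), B) L, W \ B) := by
  classical
  -- abbreviations: level and truncated parameters
  set Θl := lvTheta a Θ₀ cB with hΘl
  set Φl := lvPhi a Φ₀ Ψ₀ with hΦl
  set Ψl := lvPsi a Ψ₀ cL with hΨl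
  set Θt := trTheta a Θl with hΘt
  set Φt := trPhi a Φl with hΦt
  set Ψt := trPsi a Ψl with hΨt
  have hΨt' : Ψt = trPsi a Ψ₀ := by rw [hΨt, hΨl, trPsi_lv]
  set PL : MvPolynomial (Fin (h + h)) ℂ := ∏ ℓ ∈ L, labE Ψt ℓ with hPL
  have hPLk : ThinStep.killVars {Fin.castAdd h a} PL = PL := by
    have hfree : XFree a PL := by rw [hPL, hΨt']; exact xFree_prod L _ (fun ℓ _ => xFree_labE_tr a Ψ₀ ℓ)
    exact hfree
  have hPLfree : XFree a PL := hPLk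
  -- truncated weight products vanish on anchor sets with an `a`-root
  have hΘt_zero : ∀ J₁ : Finset (Anchor h), (∃ α ∈ J₁, a ∈ α.1) → (∏ α ∈ J₁, Θt α) = 0 := by
    intro J₁ hex; rw [hΘt, prod_trTheta, if_pos hex]
  -- the two right-hand entries in truncated form
  have hR0 : entry Θl Φl Ψl U' (L, W) = ∑ J ∈ jSet W, (∏ α ∈ J, Θt α) * coeff (pexpo U' ∅) (PL * ∏ α ∈ J, xPartE Φt α) := by
    rw [← entry_tr a Θl Φl Ψl hU', entry, colE, tW, Finset.mul_sum, coeff_sum]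
    refine Finset.sum_congr rfl (fun J _ => ?_)
    rw [show (∏ ℓ ∈ (L, W).1, labE (trPsi a Ψl) ℓ) = PL from rfl, mul_left_comm, coeff_C_mul]
  have hRB : ∀ B : Finset (Fin h), entry Θl Φl Ψl U' (insert (({a} : Finset (Fin h)), B) L, W \ B) =
      ∑ J' ∈ jSet (W \ B), (∏ α ∈ J', Θt α) * coeff (pexpo U' ∅) (labE Ψt (({a} : Finset (Fin h)), B) * PL * ∏ α ∈ J', xPartE Φt α) := by
    intro B
    have hnot : (({a} : Finset (Fin h)), B) ∉ L := fun hmem => hL _ hmem rfl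
    rw [← entry_tr a Θl Φl Ψl hU', entry, colE, tW, Finset.mul_sum, coeff_sum]
    refine Finset.sum_congr rfl (fun J _ => ?_)
    rw [show (∏ ℓ ∈ (insert (({a} : Finset (Fin h)), B) L, W \ B).1, labE (trPsi a Ψl) ℓ) = labE Ψt (({a} : Finset (Fin h)), B) * PL by
      rw [show (insert (({a} : Finset (Fin h)), B) L, W \ B).1 = insert (({a} : Finset (Fin h)), B) L from rfl, Finset.prod_insert hnot],
      mul_left_comm, coeff_C_mul]
  -- the left-hand entry, term by term
  have hL0 : entry Θl Φl Ψl (insert a U') (L, W) =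
      ∑ J ∈ jSet W, (∏ α ∈ J, Θl α) * coeff (pexpo (insert a U') ∅)
        ((PL * ∏ ℓ ∈ L, (1 + C (cL ℓ) * X (Fin.castAdd h a))) * ∏ α ∈ J, xPartE Φl α) := by
    rw [entry, colE, tW, Finset.mul_sum, coeff_sum]
    refine Finset.sum_congr rfl (fun J _ => ?_)
    rw [show (∏ ℓ ∈ (L, W).1, labE Ψl ℓ) = PL * ∏ ℓ ∈ L, (1 + C (cL ℓ) * X (Fin.castAdd h a)) by
      rw [show (L, W).1 = L from rfl, hΨl, prod_labE_lv, ← hΨt'], mul_left_comm, coeff_C_mul]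
  -- pointwise identity for each anchor set of `W`
  have hpoint : ∀ J ∈ jSet W,
      (∏ α ∈ J, Θl α) * coeff (pexpo (insert a U') ∅) ((PL * ∏ ℓ ∈ L, (1 + C (cL ℓ) * X (Fin.castAdd h a))) * ∏ α ∈ J, xPartE Φl α) =
      (∑ ℓ ∈ L, cL ℓ) * ((∏ α ∈ J, Θt α) * coeff (pexpo U' ∅) (PL * ∏ α ∈ J, xPartE Φt α)) +
      ∑ B ∈ blocks W, (if (({a} : Finset (Fin h)), B) ∈ J then
        cB B * ((∏ α ∈ J.erase (({a} : Finset (Fin h)), B), Θt α) *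
          coeff (pexpo U' ∅) (labE Ψt (({a} : Finset (Fin h)), B) * PL * ∏ α ∈ J.erase (({a} : Finset (Fin h)), B), xPartE Φt α)) else 0) := by
    intro J hJ
    by_cases hbad : ∃ α ∈ J, a ∈ α.1 ∧ α.1 ≠ {a}
    · -- case (a): an `a`-rooted anchor with a larger root: everything vanishes
      obtain ⟨α, hαJ, haα, hne⟩ := hbad
      have hl : Θl α = 0 := by rw [hΘl, lvTheta, if_pos haα, if_neg hne]
      rw [Finset.prod_eq_zero hαJ hl, zero_mul, hΘt_zero J ⟨α, hαJ, haα⟩, zero_mul, mul_zero, zero_add]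
      symm
      refine Finset.sum_eq_zero (fun B _ => ?_)
      split_ifs with hmem
      · rw [hΘt_zero (J.erase _) ⟨α, Finset.mem_erase.mpr ⟨fun heq => hne (by rw [heq]), hαJ⟩, haα⟩, zero_mul, mul_zero]
      · rfl
    push Not at hbad
    by_cases hfree : ∀ α ∈ J, a ∉ α.1
    · -- case (b): no `a`-root: the label tails give the factor `Σ cL`
      have hΘeq : (∏ α ∈ J, Θl α) = ∏ α ∈ J, Θt α := by
        refine Finset.prod_congr rfl (fun α hα => ?_)
        rw [hΘt, trTheta, if_neg (hfree α hα)]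
      obtain ⟨hkill, htr⟩ := killVars_prod_xPartE_lv_of_free a Φ₀ Ψ₀ hfree
      rw [← hΦl] at hkill htr
      rw [← hΦt] at htr
      have hXfree : XFree a (PL * ∏ α ∈ J, xPartE Φl α) := by
        rw [XFree, map_mul, hPLk, hkill]
      have hnone : ∀ B ∈ blocks W, ¬ ((({a} : Finset (Fin h)), B) ∈ J) := fun B _ hmem =>
        hfree _ hmem (Finset.mem_singleton_self a)
      rw [Finset.sum_eq_zero (s := blocks W) (fun B hB => by rw [if_neg (hnone B hB)]), add_zero, hΘeq,
        show (PL * ∏ ℓ ∈ L, (1 + C (cL ℓ) * X (Fin.castAdd h a))) * ∏ α ∈ J, xPartE Φl α =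
          (PL * ∏ α ∈ J, xPartE Φl α) * ∏ ℓ ∈ L, (1 + C (cL ℓ) * X (Fin.castAdd h a)) by ring,
        coeff_insert_mul_tails a L cL hXfree hU', htr, mul_left_comm]
    · -- case (c): some anchor is rooted exactly at `{a}`
      push Not at hfree
      obtain ⟨⟨A₀, B₀⟩, hα₀J, haα₀⟩ := hfree
      have hroot : A₀ = {a} := hbad _ hα₀J haα₀
      subst hroot
      have hΘt0 : (∏ α ∈ J, Θt α) = 0 := hΘt_zero J ⟨_, hα₀J, haα₀⟩
      rw [hΘt0, zero_mul, mul_zero, zero_add]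
      by_cases htwo : ∃ α' ∈ J, α' ≠ (({a} : Finset (Fin h)), B₀) ∧ a ∈ α'.1
      · -- (c2) two `a`-roots: `x_a²`
        obtain ⟨α', hα'J, hne', haα'⟩ := htwo
        rw [coeff_eq_zero_of_two_roots a Φl _ hα₀J hα'J hne'.symm haα₀ haα' (insert a U'), mul_zero]
        symm
        refine Finset.sum_eq_zero (fun B _ => ?_)
        split_ifs with hmem
        · -- the erased set still contains an `a`-root
          have hex : ∃ α ∈ J.erase (({a} : Finset (Fin h)), B), a ∈ α.1 := by
            by_cases hα' : α' = (({a} : Finset (Fin h)), B)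
            · refine ⟨(({a} : Finset (Fin h)), B₀), Finset.mem_erase.mpr ⟨fun heq => hne' (by rw [hα', heq]), hα₀J⟩, haα₀⟩
            · exact ⟨α', Finset.mem_erase.mpr ⟨hα', hα'J⟩, haα'⟩
          rw [hΘt_zero _ hex, zero_mul, mul_zero]
        · rfl
      · -- (c1) exactly one `a`-root `({a} | B₀)`
        push Not at htwo
        obtain ⟨hJ', hB₀⟩ := erase_mem_jSet hJ hα₀J
        have hJ'free : ∀ α ∈ J.erase (({a} : Finset (Fin h)), B₀), a ∉ α.1 := fun α hα haα =>
          htwo α (Finset.mem_of_mem_erase hα) (Finset.ne_of_mem_erase hα) haα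
        -- only the block `B₀` contributes to the sum
        have hothers : ∀ B ∈ blocks W, B ≠ B₀ → (if (({a} : Finset (Fin h)), B) ∈ J then
            cB B * ((∏ α ∈ J.erase (({a} : Finset (Fin h)), B), Θt α) *
              coeff (pexpo U' ∅) (labE Ψt (({a} : Finset (Fin h)), B) * PL * ∏ α ∈ J.erase (({a} : Finset (Fin h)), B), xPartE Φt α)) else 0) = 0 := by
          intro B _ hBne
          rw [if_neg]
          intro hmem
          have hne : ((({a} : Finset (Fin h)), B) : Anchor h) ≠ (({a} : Finset (Fin h)), B₀) := fun heq => hBne (congrArg Prod.snd heq)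
          exact htwo _ hmem hne (Finset.mem_singleton_self a)
        rw [Finset.sum_eq_single_of_mem B₀ hB₀ hothers, if_pos hα₀J]
        -- weights
        have hΘprod : (∏ α ∈ J, Θl α) = cB B₀ * ∏ α ∈ J.erase (({a} : Finset (Fin h)), B₀), Θt α := by
          rw [← Finset.mul_prod_erase J _ hα₀J]
          congr 1
          · rw [hΘl, lvTheta]; simp only [Finset.mem_singleton_self, if_true]
          · exact Finset.prod_congr rfl (fun α hα => by
              rw [hΘt, trTheta, if_neg (hJ'free α hα), hΘl, lvTheta, if_neg (hJ'free α hα)])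
        -- the reading: pull out `x_a` from the anchor `({a} | B₀)`
        obtain ⟨hkill, htr⟩ := killVars_prod_xPartE_lv_of_free a Φ₀ Ψ₀ hJ'free
        rw [← hΦl] at hkill htr
        rw [← hΦt] at htr
        have htails : ThinStep.killVars {Fin.castAdd h a} (∏ ℓ ∈ L, (1 + C (cL ℓ) * X (R := ℂ) (Fin.castAdd h a))) = 1 := by
          rw [map_prod]
          refine Finset.prod_eq_one (fun ℓ _ => ?_)
          rw [map_add, map_one, map_mul, ThinStep.killVars_C, ThinStep.killVars_X, if_pos (Finset.mem_singleton_self _), mul_zero, add_zero]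
        have htail₀ : ThinStep.killVars {Fin.castAdd h a} (tailE Φl (({a} : Finset (Fin h)), B₀)) = labE Ψt (({a} : Finset (Fin h)), B₀) := by
          rw [hΨt', ← tailE_lv_root a Φ₀ Ψ₀ B₀, ← hΦl, tailE, map_prod]
          refine Finset.prod_congr rfl (fun b hb => ?_)
          have hba : b ≠ a := by
            intro heq; rw [heq] at hb; exact (Finset.mem_sdiff.mp hb).2 (Finset.mem_singleton_self a)
          rw [map_add, map_one, map_mul, ThinStep.killVars_C, ThinStep.killVars_X,
            if_neg (fun hmem => hba (Fin.castAdd_injective _ _ (Finset.mem_singleton.mp hmem)))]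
        have hread : coeff (pexpo (insert a U') ∅) ((PL * ∏ ℓ ∈ L, (1 + C (cL ℓ) * X (Fin.castAdd h a))) * ∏ α ∈ J, xPartE Φl α) =
            coeff (pexpo U' ∅) (labE Ψt (({a} : Finset (Fin h)), B₀) * PL * ∏ α ∈ J.erase (({a} : Finset (Fin h)), B₀), xPartE Φt α) := by
          rw [← Finset.mul_prod_erase J (fun α => xPartE Φl α) hα₀J, xPartE_eq_X_mul a Φl haα₀]
          have hA : ((({a} : Finset (Fin h)), B₀) : Anchor h).1.erase a = ∅ := by
            show ({a} : Finset (Fin h)).erase a = ∅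
            exact Finset.erase_singleton a
          rw [hA, Finset.prod_empty, one_mul]
          -- move `x_a` to the front: (PL·T)·((x·E)·Q) = x·(((PL·T)·E)·Q)
          rw [mul_assoc (X (Fin.castAdd h a)) (tailE Φl _) _, mul_left_comm (PL * _) (X (Fin.castAdd h a)) _,
            ← mul_assoc (PL * _) (tailE Φl _) _,
            coeff_insert_X_mul a _ hU', map_mul, map_mul, map_mul, hPLk, hkill, htails, mul_one, htail₀, htr, mul_comm PL (labE Ψt _)]
        rw [hΘprod, hread, mul_assoc]
  -- assemble
  rw [hL0, Finset.sum_congr rfl hpoint, Finset.sum_add_distrib, ← Finset.mul_sum, ← hR0, Finset.sum_comm]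
  congr 1
  refine Finset.sum_congr rfl (fun B hB => ?_)
  rw [hRB B, Finset.mul_sum]
  -- reindex the anchor sets of `W` through `({a}|B)` by those of `W \ B`
  symm
  rw [← Finset.sum_filter]
  refine Finset.sum_nbij' (fun J' => insert (({a} : Finset (Fin h)), B) J') (fun J => J.erase (({a} : Finset (Fin h)), B)) ?_ ?_ ?_ ?_ ?_
  · intro J' hJ'
    obtain ⟨hmem, _⟩ := insert_mem_jSet hB hJ'
    exact Finset.mem_filter.mpr ⟨hmem, Finset.mem_insert_self _ _⟩
  · intro J hJ
    obtain ⟨hJW, hmem⟩ := Finset.mem_filter.mp hJ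
    exact (erase_mem_jSet hJW hmem).1
  · intro J' hJ'
    exact Finset.erase_insert (insert_mem_jSet hB hJ').2
  · intro J hJ
    exact Finset.insert_erase (Finset.mem_filter.mp hJ).2
  · intro J' hJ'
    simp only [Finset.erase_insert (insert_mem_jSet hB hJ').2]

end Row

end XElim

end

end Summit.ValiantsHypothesis.ValiantsHypothesis.Theorems.BarrierLever.AnchoredPeeling
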